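import Mathlib

/-!
# PneNP / OverlapGapAlgebra — crux `SolvableImpliesStableSection` (stmt-PneNP-2463):
# the TWO-WAY REPAIR block (9/·) — clause-walks up a syntactically valid two-way tree

Support for crux `stmt-PneNP-2463` (`Summit.PneNP.PneNP.Theses.OverlapGapAlgebra.SolvableImpliesStableSection`):
the f-free block "bounded-round two-way repair with one-round memory gives stable sections for every
`ν > 0` up to `α ≤ 2^k/(4k)`".  In a tree code `T` that is syntactically valid in `Φ` for the TWO-WAY
sign rule (`…TwoWayRepairTreeCount`), every edge from a node `(a, (x, r))` to a child `(j :: a, (y, s))`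
is a shared variable — `var(x, j) = var(y, jn)` for the least childless slot `jn` of the child — and the
two signs ALTERNATE: `(x, j)` is positive iff the child's code `s` is even, `(y, jn)` is positive iff
`s` is odd.  Walking from a node up to the root therefore gives a clause-walk that is non-degenerate in
the sense of `…TwoWayRepairWalkOps` (in-slots bear children, out-slots are childless; consecutive equal
clauses use slots of different signs):

* `sissW_edge_facts` — the variable, least-childless-slot and sign facts of a tree edge;
* `sissW_upWalk` — for every node `(a, (x, r))`: a clause-walk `w 0 = x, …, w |a| = root clause` with
  the step equations, in-slot `≠` out-slot at the inner clauses, different slots at consecutive equal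
  clauses, `o 0` childless at `a` (if `a ≠ []`), and `w d` the clause at the ancestor address `a.drop d`.
No definitions (all objects are hypotheses); axioms `propext`, `Classical.choice`, `Quot.sound`.
-/

set_option linter.dupNamespace false -- `Summit.PneNP.PneNP.…`: summit = sub-problem (D-0017)

namespace Summit.PneNP.PneNP.Theorems

open Finset
open scoped Classical

section TreeWalks

variable {m k n : ℕ}

/-- **Edge facts (two-way rule).** In a functional, syntactically valid tree code, for a node
`(a, (x, r))` with child `(j :: a, (y, s))` and the least childless slot `jn` of the child:
`var(x, j) = var(y, jn)`, `(x, j)` is positive iff `s` is even, and `(y, jn)` is positive iff `s` is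
odd. -/
theorem sissW_edge_facts (T : Finset (List (Fin k) × (Fin m × ℕ))) (Φ : (Fin m → Fin k → Fin n × Bool))
    (hfun : ∀ (a : List (Fin k)) (lab lab' : Fin m × ℕ), (a, lab) ∈ T → (a, lab') ∈ T → lab = lab')
    (hsyn : ∀ e ∈ T, ∀ j : Fin k,
      (((Φ e.2.1 j).2 = true ↔ ((∃ (y : Fin m) (s : ℕ), (j :: e.1, (y, s)) ∈ T ∧ s % 2 = 0) ∨
        ((∀ lab : Fin m × ℕ, (j :: e.1, lab) ∉ T) ∧ e.2.2 % 2 = 1))) ∧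
      ∀ (y : Fin m) (s : ℕ), (j :: e.1, (y, s)) ∈ T → ∃ j' : Fin k,
        (∀ lab : Fin m × ℕ, (j' :: j :: e.1, lab) ∉ T) ∧
        (∀ j'' : Fin k, j'' < j' → ∃ lab : Fin m × ℕ, (j'' :: j :: e.1, lab) ∈ T) ∧
        (Φ e.2.1 j).1 = (Φ y j').1))
    (a : List (Fin k)) (x : Fin m) (r : ℕ) (ha : (a, (x, r)) ∈ T)
    (j : Fin k) (y : Fin m) (s : ℕ) (hch : (j :: a, (y, s)) ∈ T) :
    ∃ jn : Fin k, (∀ lab : Fin m × ℕ, (jn :: j :: a, lab) ∉ T) ∧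
      (∀ j'' : Fin k, j'' < jn → ∃ lab : Fin m × ℕ, (j'' :: j :: a, lab) ∈ T) ∧
      (Φ x j).1 = (Φ y jn).1 ∧ ((Φ x j).2 = true ↔ s % 2 = 0) ∧ ((Φ y jn).2 = true ↔ s % 2 = 1) := by
  obtain ⟨hsgn, hchild⟩ := hsyn (a, (x, r)) ha j
  obtain ⟨jn, hno, hlt, heq⟩ := hchild y s hch
  refine ⟨jn, hno, hlt, heq, ?_, ?_⟩
  · rw [hsgn]
    constructor
    · rintro (⟨y', s', hys', hpar⟩ | ⟨hnone, _⟩)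
      · have := hfun (j :: a) (y, s) (y', s') hch hys'
        rw [Prod.mk.injEq] at this
        rw [this.2]
        exact hpar
      · exact absurd hch (hnone (y, s))
    · intro hpar
      exact Or.inl ⟨y, s, hch, hpar⟩
  · have hsgn' := (hsyn (j :: a, (y, s)) hch jn).1
    rw [hsgn']
    constructor
    · rintro (⟨y', s', hys', _⟩ | ⟨_, hodd⟩)
      · exact absurd hys' (hno (y', s'))
      · exact hodd
    · intro hodd
      exact Or.inr ⟨hno, hodd⟩

/-- **The walk from a node up to the root (two-way rule).** In a functional, parent-closed,
syntactically valid tree code with root clause `c`, for every node `(a, (x, r))` there is a clause-walk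
`w, u, o` of length `|a|` with `w 0 = x`, `w |a| = c`, the step equations
`var(w (d+1), u (d+1)) = var(w d, o d)`, in-slot `≠` out-slot at the clauses `1, …, |a| - 1`,
different slots at consecutive equal clauses, `o 0` a childless slot at `a` when `a ≠ []`, and `w d` the
clause at the ancestor address `a.drop d`. -/
theorem sissW_upWalk (T : Finset (List (Fin k) × (Fin m × ℕ))) (Φ : (Fin m → Fin k → Fin n × Bool))
    (hfun : ∀ (a : List (Fin k)) (lab lab' : Fin m × ℕ), (a, lab) ∈ T → (a, lab') ∈ T → lab = lab')
    (hpar : ∀ (j : Fin k) (a : List (Fin k)) (lab : Fin m × ℕ), (j :: a, lab) ∈ T →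
      ∃ lab' : Fin m × ℕ, (a, lab') ∈ T)
    (hsyn : ∀ e ∈ T, ∀ j : Fin k,
      (((Φ e.2.1 j).2 = true ↔ ((∃ (y : Fin m) (s : ℕ), (j :: e.1, (y, s)) ∈ T ∧ s % 2 = 0) ∨
        ((∀ lab : Fin m × ℕ, (j :: e.1, lab) ∉ T) ∧ e.2.2 % 2 = 1))) ∧
      ∀ (y : Fin m) (s : ℕ), (j :: e.1, (y, s)) ∈ T → ∃ j' : Fin k,
        (∀ lab : Fin m × ℕ, (j' :: j :: e.1, lab) ∉ T) ∧
        (∀ j'' : Fin k, j'' < j' → ∃ lab : Fin m × ℕ, (j'' :: j :: e.1, lab) ∈ T) ∧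
        (Φ e.2.1 j).1 = (Φ y j').1))
    (c : Fin m) (rc : ℕ) (hroot : (([] : List (Fin k)), (c, rc)) ∈ T) (j₀ : Fin k) :
    ∀ (a : List (Fin k)) (x : Fin m) (r : ℕ), (a, (x, r)) ∈ T →
      ∃ (w : ℕ → Fin m) (u o : ℕ → Fin k), w 0 = x ∧ w a.length = c ∧
        (∀ d, d < a.length → (Φ (w (d + 1)) (u (d + 1))).1 = (Φ (w d) (o d)).1) ∧
        (∀ i, 1 ≤ i → i < a.length → u i ≠ o i) ∧
        (∀ d, d < a.length → w (d + 1) = w d → u (d + 1) ≠ o d) ∧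
        (a ≠ [] → ∀ lab : Fin m × ℕ, (o 0 :: a, lab) ∉ T) ∧
        (∀ d, d ≤ a.length → ∃ r' : ℕ, (a.drop d, (w d, r')) ∈ T) := by
  intro a
  induction a with
  | nil =>
    intro x r ha
    have hxc : x = c := by
      have := hfun [] (x, r) (c, rc) ha hroot
      exact (Prod.mk.inj this).1
    refine ⟨fun _ => x, fun _ => j₀, fun _ => j₀, rfl, hxc, fun d hd => absurd hd (Nat.not_lt_zero d),
      fun i h1 h2 => by simp at h2, fun d hd => absurd hd (Nat.not_lt_zero d),
      fun h => absurd rfl h, fun d hd => ?_⟩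
    have hd0 : d = 0 := by simpa using hd
    subst hd0
    exact ⟨r, by simpa using ha⟩
  | cons j a' ih =>
    intro x r ha
    obtain ⟨⟨x', r'⟩, ha'⟩ := hpar j a' (x, r) ha
    obtain ⟨w', u', o', hw0, hwlen, hsteps, hio, hsep, hless, hnode⟩ := ih x' r' ha'
    obtain ⟨jn, hjn, _, heq, hsx, hsy⟩ := sissW_edge_facts T Φ hfun hsyn a' x' r' ha' j x r ha
    refine ⟨fun i => if i = 0 then x else w' (i - 1),
      fun i => if i = 1 then j else u' (i - 1),
      fun i => if i = 0 then jn else o' (i - 1), by simp, ?_, ?_, ?_, ?_, ?_, ?_⟩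
    · have hne0 : a'.length + 1 ≠ 0 := by omega
      simp only [List.length_cons, hne0, if_false, Nat.add_sub_cancel]
      exact hwlen
    · intro d hd
      rw [List.length_cons] at hd
      rcases Nat.eq_zero_or_pos d with rfl | hdpos
      · simp only [Nat.zero_add, if_true, one_ne_zero, if_false, Nat.sub_self]
        rw [hw0]
        exact heq
      · have h1 : d + 1 ≠ 1 := by omega
        have h2 : d + 1 ≠ 0 := by omega
        have h3 : d ≠ 0 := by omega
        simp only [h1, h2, h3, if_false, Nat.add_sub_cancel]
        have := hsteps (d - 1) (by omega)
        rwa [Nat.sub_add_cancel hdpos] at this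
    · -- in-slot ≠ out-slot at the inner clauses
      intro i h1 h2
      rw [List.length_cons] at h2
      by_cases hi1 : i = 1
      · subst hi1
        simp only [if_true, one_ne_zero, if_false, Nat.sub_self]
        -- `j` bears a child at `a'`, `o' 0` is childless there (`a' ≠ []` as `1 < |a'| + 1`)
        have hne : a' ≠ [] := by
          intro h; subst h; simp at h2
        intro hcon
        exact hless hne (x, r) (by rw [← hcon]; exact ha)
      · have h3 : i ≠ 0 := by omega
        simp only [hi1, h3, if_false]
        exact hio (i - 1) (by omega) (by omega)
    · -- consecutive equal clauses use different slots (alternating signs along an edge)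
      intro d hd
      rw [List.length_cons] at hd
      rcases Nat.eq_zero_or_pos d with rfl | hdpos
      · simp only [Nat.zero_add, if_true, one_ne_zero, if_false, Nat.sub_self]
        rw [hw0]
        intro hxx hjj
        rw [hxx, hjj] at hsx
        rw [hsx] at hsy
        omega
      · have h1 : d + 1 ≠ 1 := by omega
        have h2 : d + 1 ≠ 0 := by omega
        have h3 : d ≠ 0 := by omega
        simp only [h1, h2, h3, if_false, Nat.add_sub_cancel]
        intro hww
        have := hsep (d - 1) (by omega) (by rwa [Nat.sub_add_cancel hdpos])
        rwa [Nat.sub_add_cancel hdpos] at this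
    · intro _
      simp only [if_true]
      exact hjn
    · intro d hd
      rw [List.length_cons] at hd
      rcases Nat.eq_zero_or_pos d with rfl | hdpos
      · simp only [if_true, List.drop_zero]
        exact ⟨r, ha⟩
      · have h3 : d ≠ 0 := by omega
        simp only [h3, if_false]
        obtain ⟨r'', hr''⟩ := hnode (d - 1) (by omega)
        refine ⟨r'', ?_⟩
        have hdrop : (j :: a').drop d = a'.drop (d - 1) := by
          obtain ⟨e, rfl⟩ := Nat.exists_eq_add_of_le hdpos
          rw [Nat.add_comm, List.drop_succ_cons, Nat.add_sub_cancel]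
        rw [hdrop]
        exact hr''

end TreeWalks

end Summit.PneNP.PneNP.Theorems
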